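import Summits.CriticalPhenomena.PercolationContinuityZ3.Theorems.PercNearOneGluingNoHeavyRsw3InvasionSwallowedClusters
import HarnessLib

/-!
# RSW3 lane (P2, gen 28): INVASION PERCOLATION XXIV — FROM A UNIFORM EXPONENTIAL VOLUME TAIL TO A POSITIVE RATE OF OUTLETS
# (every infinite connected locally finite graph)

builds on p205010 (kernel theorem, internal audit signed; external expert review pending) — NOT used in this file.

Cell `prim-rsw3`, prover seat `prim-rsw3-p2` (gen 28), memo `run/shared/lean/prim/rsw3/P2-RSWLITE.md` §35.  Support file
(`--supports stmt-CriticalPhenomena-4575`); no definitions, no named facts, no sorries.  `M_n(y) = badCount … y n = #{k < n : x_k > y}` is the number of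
OUTLETS at level `y` among the first `n` steps of the invasion from `o`; `C_y(v)` the level-`y` cluster of `v` under the label field.

The graph-independent end of Chayes–Chayes–Newman's Lemma 3.4 argument: if at level `y` the cluster volumes have a UNIFORM exponential tail,
`μ{m ≤ |C_y(v)|} ≤ A e^{−λ m}` for all vertices `v` and `m ≥ 1` (on `ℤ^d`: every `y < p_c`, by sharpness; on any transitive graph: every `y` below
the uniqueness of the exponential-decay phase), then file XXIII's supermartingale bound applies with `q_m = A e^{−λm}`, `t = λ/2` and the
`L`-independent majorant `Φ = 1 + A Σ_m e^{−λm/2}`, giving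

* **`exists_badCount_tail_of_exp_volume_tail`** — `∃ Φ ≥ 1, s > 0: μ{M_N(y) ≤ k} ≤ Φ^{k+1}·e^{−s(N+1)}` for all `N, k`;
* **`ae_eventually_mul_le_badCount_of_exp_volume_tail`** — `∃ c > 0`: almost surely `c·n ≤ M_n(y)` for all large `n` (Borel–Cantelli with
  `k = ⌊cn⌋`, `c = s/(2(log Φ + 1))`): **A POSITIVE RATE OF OUTLETS**, i.e. the swallowed clusters have bounded average size along the invasion.
File XXV (`…Rsw3InvasionOutletDensity`) supplies the tail on `ℤ^d` below `p_c` (Hutchcroft) and draws the dichotomy with gen 27's zero density at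
and above `p_c`.

References: J. T. Chayes, L. Chayes, C. M. Newman, Comm. Math. Phys. 101 (1985) 383–407, Lemma 3.4, Thm 3.3 [ChayesChayesNewman1985].
-/

noncomputable section

namespace Summit.CriticalPhenomena.PercolationContinuityZ3.Theorems.Rsw3

open Finset MeasureTheory Filter Topology Literature.Probability.Percolation Literature.Probability.Percolation.Invasion
open scoped ENNReal

section General

variable {V : Type*} [DecidableEq V] {G : SimpleGraph V} [G.LocallyFinite] [Countable V] [Infinite V]

/-- **FEW OUTLETS ARE EXPONENTIALLY UNLIKELY under a uniform exponential volume tail**: on an infinite connected locally finite graph with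
countable vertex set, if `μ{m ≤ |C_y(v)|} ≤ A e^{−λm}` (`A ≥ 0`, `λ > 0`, all `v`, `m ≥ 1`), then there are `Φ ≥ 1` and `s > 0` with
`μ{M_N(y) ≤ k} ≤ Φ^{k+1}·e^{−s(N+1)}` for all `N, k` (file XXIII with `q_m = A e^{−λm}`, `t = λ/2`, `Φ = 1 + A Σ_m e^{−λm/2}`).
[cite: ChayesChayesNewman1985, Lemma 3.4 and Thm 3.3] -/
theorem exists_badCount_tail_of_exp_volume_tail (hG : G.Preconnected) (o : V) (y : ℝ) {A lam : ℝ} (hA : 0 ≤ A) (hlam : 0 < lam)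
    (htail : ∀ (v : V) (m : ℕ), 1 ≤ m →
      (labelMeasure V).real {U : Sym2 V → ℝ | (m : ℕ∞) ≤ (openCluster (configOfLabels y U G) v).encard} ≤ A * Real.exp (-(lam * m))) :
    ∃ Φ s : ℝ, 1 ≤ Φ ∧ 0 < s ∧ ∀ N k : ℕ,
      (labelMeasure V).real {U | badCount G U o y N ≤ k} ≤ Φ ^ (k + 1) * Real.exp (-(s * (N + 1))) := by
  -- the geometric majorant
  set r : ℝ := Real.exp (-(lam / 2)) with hr
  have hr0 : 0 < r := Real.exp_pos _
  have hr1 : r < 1 := Real.exp_lt_one_iff.2 (by linarith)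
  have hsumr : Summable fun m : ℕ => r ^ m := summable_geometric_of_lt_one hr0.le hr1
  set Φ : ℝ := 1 + A * ∑' m : ℕ, r ^ m with hΦ
  have hΦ1 : 1 ≤ Φ := by
    have : 0 ≤ A * ∑' m : ℕ, r ^ m := mul_nonneg hA (tsum_nonneg fun m => pow_nonneg hr0.le m)
    linarith
  refine ⟨Φ, lam / 2, hΦ1, by linarith, fun N k => ?_⟩
  have hΦL : 1 + ∑ m ∈ Icc 1 (N + 1), (Real.exp (lam / 2 * m) - Real.exp (lam / 2 * (m - 1))) * (A * Real.exp (-(lam * m))) ≤ Φ := by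
    have hterm : ∀ m ∈ Icc 1 (N + 1),
        (Real.exp (lam / 2 * m) - Real.exp (lam / 2 * (m - 1))) * (A * Real.exp (-(lam * m))) ≤ A * r ^ m := by
      intro m _
      have hsub : Real.exp (lam / 2 * m) - Real.exp (lam / 2 * (m - 1)) ≤ Real.exp (lam / 2 * m) := by
        linarith [Real.exp_nonneg (lam / 2 * (m - 1))]
      have hrm : Real.exp (lam / 2 * m) * Real.exp (-(lam * m)) = r ^ m := by
        rw [hr, ← Real.exp_nat_mul, ← Real.exp_add]; congr 1; ring
      calc (Real.exp (lam / 2 * m) - Real.exp (lam / 2 * (m - 1))) * (A * Real.exp (-(lam * m)))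
          ≤ Real.exp (lam / 2 * m) * (A * Real.exp (-(lam * m))) :=
            mul_le_mul_of_nonneg_right hsub (mul_nonneg hA (Real.exp_nonneg _))
        _ = A * r ^ m := by rw [← hrm]; ring
    calc 1 + ∑ m ∈ Icc 1 (N + 1), (Real.exp (lam / 2 * m) - Real.exp (lam / 2 * (m - 1))) * (A * Real.exp (-(lam * m)))
        ≤ 1 + ∑ m ∈ Icc 1 (N + 1), A * r ^ m := by have := Finset.sum_le_sum hterm; linarith
      _ = 1 + A * ∑ m ∈ Icc 1 (N + 1), r ^ m := by rw [Finset.mul_sum]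
      _ ≤ Φ := by
        rw [hΦ]
        gcongr
        exact Summable.sum_le_tsum _ (fun m _ => pow_nonneg hr0.le m) hsumr
  exact labelMeasure_real_badCount_le_le hG o y (le_of_lt (half_pos hlam)) N (fun m => A * Real.exp (-(lam * m)))
    (fun v m hm _ => htail v m hm) hΦ1 hΦL k

/-- **A UNIFORM EXPONENTIAL VOLUME TAIL GIVES A POSITIVE RATE OF OUTLETS**: under the hypotheses of the previous theorem there is `c > 0` such
that, almost surely, `c·n ≤ M_n(y)` for all large `n` (Borel–Cantelli on `μ{M_N(y) ≤ ⌊cN⌋} ≤ Φ e^{−sN/2}`, `c = s/(2(log Φ + 1))`) — along the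
invasion the swallowed `y`-clusters have bounded average size. [cite: ChayesChayesNewman1985, Thm 3.3 (C bounded away from 0) and Lemma 3.4] -/
theorem ae_eventually_mul_le_badCount_of_exp_volume_tail (hG : G.Preconnected) (o : V) (y : ℝ) {A lam : ℝ} (hA : 0 ≤ A) (hlam : 0 < lam)
    (htail : ∀ (v : V) (m : ℕ), 1 ≤ m →
      (labelMeasure V).real {U : Sym2 V → ℝ | (m : ℕ∞) ≤ (openCluster (configOfLabels y U G) v).encard} ≤ A * Real.exp (-(lam * m))) :
    ∃ c : ℝ, 0 < c ∧ ∀ᵐ U ∂(labelMeasure V), ∀ᶠ n : ℕ in atTop, c * n ≤ badCount G U o y n := by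
  haveI : IsProbabilityMeasure (labelMeasure V) := isProbabilityMeasure_labelMeasure _
  obtain ⟨Φ, s, hΦ1, hs, hbnd⟩ := exists_badCount_tail_of_exp_volume_tail hG o y hA hlam htail
  have hΦ0 : 0 < Φ := by linarith
  have hlog : 0 ≤ Real.log Φ := Real.log_nonneg hΦ1
  set c : ℝ := s / (2 * (Real.log Φ + 1)) with hc
  have hc0 : 0 < c := by positivity
  have hclog : c * Real.log Φ ≤ s / 2 := by
    rw [hc, div_mul_eq_mul_div, div_le_div_iff₀ (by positivity) (by norm_num)]
    nlinarith
  refine ⟨c, hc0, ?_⟩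
  -- Borel–Cantelli
  set Bad : ℕ → Set (Sym2 V → ℝ) := fun N => {U | badCount G U o y N ≤ ⌊c * N⌋₊} with hBad
  have hbound : ∀ N : ℕ, labelMeasure V (Bad N) ≤ ENNReal.ofReal (Φ * Real.exp (-(s / 2)) ^ N) := by
    intro N
    rw [← ofReal_measureReal (measure_ne_top _ _)]
    refine ENNReal.ofReal_le_ofReal ((hbnd N ⌊c * N⌋₊).trans ?_)
    have hk : (⌊c * N⌋₊ : ℝ) ≤ c * N := Nat.floor_le (by positivity)
    have hpow : Φ ^ (⌊c * N⌋₊ + 1) ≤ Φ * Real.exp (s / 2 * N) := by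
      rw [pow_succ', ← Real.exp_log hΦ0, ← Real.exp_nat_mul, Real.exp_log hΦ0]
      refine mul_le_mul_of_nonneg_left (Real.exp_le_exp.2 ?_) hΦ0.le
      calc (⌊c * N⌋₊ : ℝ) * Real.log Φ ≤ c * N * Real.log Φ := mul_le_mul_of_nonneg_right hk hlog
        _ = (c * Real.log Φ) * N := by ring
        _ ≤ s / 2 * N := mul_le_mul_of_nonneg_right hclog (Nat.cast_nonneg N)
    calc Φ ^ (⌊c * N⌋₊ + 1) * Real.exp (-(s * (N + 1)))
        ≤ Φ * Real.exp (s / 2 * N) * Real.exp (-(s * (N + 1))) := mul_le_mul_of_nonneg_right hpow (Real.exp_nonneg _)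
      _ = Φ * Real.exp (-(s / 2) * N) * Real.exp (-s) := by rw [mul_assoc, mul_assoc, ← Real.exp_add, ← Real.exp_add]; congr 2; ring
      _ ≤ Φ * Real.exp (-(s / 2) * N) * 1 := by gcongr; exact Real.exp_le_one_iff.2 (by linarith)
      _ = Φ * Real.exp (-(s / 2)) ^ N := by rw [mul_one, ← Real.exp_nat_mul]; ring_nf
  have hsum : ∑' N, labelMeasure V (Bad N) ≠ ∞ := by
    have hgeo : Summable fun N : ℕ => Φ * Real.exp (-(s / 2)) ^ N :=
      (summable_geometric_of_lt_one (Real.exp_nonneg _) (Real.exp_lt_one_iff.2 (by linarith))).mul_left Φ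
    refine ne_top_of_le_ne_top ?_ (ENNReal.tsum_le_tsum hbound)
    rw [← ENNReal.ofReal_tsum_of_nonneg (fun N => by positivity) hgeo]
    exact ENNReal.ofReal_ne_top
  filter_upwards [ae_eventually_notMem hsum] with U hU
  filter_upwards [hU] with N hN
  simp only [hBad, Set.mem_setOf_eq, not_le] at hN
  have h1 : c * N < (badCount G U o y N : ℝ) := by
    calc c * N < (⌊c * N⌋₊ : ℝ) + 1 := Nat.lt_floor_add_one _
      _ ≤ badCount G U o y N := by exact_mod_cast hN
  exact h1.le

end General

end Summit.CriticalPhenomena.PercolationContinuityZ3.Theorems.Rsw3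

end
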